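import Summits.RiemannHypothesis.RiemannHypothesis.Theorems.SuzukiFlowPairingGaussInner

/-!
# Operator side of `FlowPairing`: the Gauss–digamma series through the outer window integral
# (column DBR; RH-FREE)

RH-FREE throughout; nothing here bears on the truth of RH.  Continuation of
`Theorems.SuzukiFlowPairingGaussInner`: with `G = 𝖪_θ[t]f` (`f ∈ L¹(−t,t)`),
`B_k(x) = G(x)/(k+1) − 2∫₀^∞ e^{−(2k+½)v} G(x−v) dv` (the inner window integral of the `k`-th Gauss piece)
and the window pairing `Φ(v) = ∫_{(−t,t)} G(x)G(x−v) dx`,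

* `abs_gaussInner_le` — `|B_k(x)| ≤ b_k ‖f‖₁` for `x ≤ t`, `b_k` the summable majorant of
  `Theorems.SuzukiFlowPairingGaussBound`;
* **`integral_winOp_mul_gaussSeries`** —
  `∫_{(−t,t)} G(x)·(Σ' k B_k(x)) dx = Σ' k (Φ(0)/(k+1) − 2∫₀^∞ e^{−(2k+½)v} Φ(v) dv)`
  (`integral_tsum_of_summable_integral_norm`, then `integral_winOp_mul_expPiece` termwise).

Together with `integral_gaussSeries_mul_eq_tsum` this carries the digamma part of `J_θ` through both window
integrations of `⟨𝖪_θ[t]f, 𝒥_θ[t]f⟩`.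

References: [Su20] M. Suzuki, ASPM 84 (2020); E. Bombieri, Rend. Lincei (9) 11 (2000), §2.
-/

noncomputable section

-- D-0017: `Summit.<S>.<S>.…` is the designed namespace of a single-problem summit.
set_option linter.dupNamespace false

open Complex MeasureTheory Set Filter Topology
open scoped Real

namespace Summit.RiemannHypothesis.RiemannHypothesis.Theorems.SuzukiThetaFlow

open Literature.NumberTheory.LFunctions
open Summit.RiemannHypothesis.RiemannHypothesis.Theorems.SuzukiKernelSemigroup
open Summit.RiemannHypothesis.RiemannHypothesis.Theorems.SuzukiFlowPairing

variable {θ t : ℝ} {f : ℝ → ℝ}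

/-- RH-FREE.  **Bound of the inner Gauss integrals**: with the data `(M, C, ε)` of `abs_gaussPiece_le hθ (2|t|)`,
`|B_k(x)| ≤ b_k · ‖f‖_{L¹(−t,t)}` for `x ≤ t`. -/
theorem abs_gaussInner_le (hθ : 1 < θ) (hf : IntegrableOn f (Ioo (-t) t)) {M C ε : ℝ}
    (hτ : ∀ w : ℝ, w ≤ 2 * |t| → ∀ k : ℕ,
      |limKernel θ w / ((k : ℝ) + 1) -
          2 * ∫ v in Ioi (0 : ℝ), Real.exp ((-2 * (k : ℝ) - 1 / 2) * v) * limKernel θ (w - v)| ≤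
        4 * π * (3 * M / ((k : ℝ) + 1) ^ 2 +
          (2 * C + 4 * M) * Real.Gamma (ε + 1) * (1 / (2 * (k : ℝ) + 1 / 2)) ^ (ε + 1)))
    (k : ℕ) {x : ℝ} (hx : x ≤ t) :
    |winOp (limKernel θ) t f x / ((k : ℝ) + 1) -
        2 * ∫ v in Ioi (0 : ℝ), Real.exp ((-2 * (k : ℝ) - 1 / 2) * v) * winOp (limKernel θ) t f (x - v)| ≤
      4 * π * (3 * M / ((k : ℝ) + 1) ^ 2 +
          (2 * C + 4 * M) * Real.Gamma (ε + 1) * (1 / (2 * (k : ℝ) + 1 / 2)) ^ (ε + 1)) *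
        ∫ y in Ioo (-t) t, |f y| := by
  set b : ℝ := 4 * π * (3 * M / ((k : ℝ) + 1) ^ 2 +
    (2 * C + 4 * M) * Real.Gamma (ε + 1) * (1 / (2 * (k : ℝ) + 1 / 2)) ^ (ε + 1)) with hb
  rw [← integral_gaussPiece_mul hθ hf k x, ← Real.norm_eq_abs, ← integral_const_mul]
  refine norm_integral_le_of_norm_le (hf.abs.const_mul b) ?_
  refine (ae_restrict_iff' measurableSet_Ioo).2 (Eventually.of_forall fun y hy ↦ ?_)
  rw [norm_mul, Real.norm_eq_abs, Real.norm_eq_abs]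
  exact mul_le_mul_of_nonneg_right (hτ (x + y) (by linarith [hy.2, le_abs_self t]) k) (abs_nonneg _)

/-- **RH-FREE · the Gauss–digamma series through the outer window integral**: for `θ > 1`, `f ∈ L¹(−t,t)`,
`G = 𝖪_θ[t]f`,
`∫_{(−t,t)} G(x)·Σ' k (G(x)/(k+1) − 2∫₀^∞e^{−(2k+½)v}G(x−v)dv) dx`
`  = Σ' k ((∫_{(−t,t)} G(x)² dx)/(k+1) − 2∫₀^∞ e^{−(2k+½)v} (∫_{(−t,t)} G(x)G(x−v) dx) dv)`.
Nothing here bears on RH. -/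
theorem integral_winOp_mul_gaussSeries (hθ : 1 < θ) (hf : IntegrableOn f (Ioo (-t) t)) :
    ∫ x in Ioo (-t) t, winOp (limKernel θ) t f x *
        ∑' k : ℕ, (winOp (limKernel θ) t f x / ((k : ℝ) + 1) -
          2 * ∫ v in Ioi (0 : ℝ), Real.exp ((-2 * (k : ℝ) - 1 / 2) * v) * winOp (limKernel θ) t f (x - v)) =
      ∑' k : ℕ, ((∫ x in Ioo (-t) t, winOp (limKernel θ) t f x * winOp (limKernel θ) t f x) / ((k : ℝ) + 1) -
        2 * ∫ v in Ioi (0 : ℝ), Real.exp ((-2 * (k : ℝ) - 1 / 2) * v) *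
          ∫ x in Ioo (-t) t, winOp (limKernel θ) t f x * winOp (limKernel θ) t f (x - v)) := by
  obtain ⟨M, C, ε, hM0, hC, hε0, -, hτ⟩ := abs_gaussPiece_le hθ (2 * |t|)
  have hsum := summable_archSeriesMajorant M C ε hε0
  obtain ⟨MG, hMG0, hMG⟩ := exists_abs_winOp_le hθ hf
  have hGc := continuous_winOp hθ hf
  set L : ℝ := ∫ y in Ioo (-t) t, |f y| with hL
  have hL0 : 0 ≤ L := integral_nonneg fun _ ↦ abs_nonneg _
  set F : ℕ → ℝ → ℝ := fun k x ↦ winOp (limKernel θ) t f x *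
    (winOp (limKernel θ) t f x / ((k : ℝ) + 1) -
      2 * ∫ v in Ioi (0 : ℝ), Real.exp ((-2 * (k : ℝ) - 1 / 2) * v) * winOp (limKernel θ) t f (x - v)) with hF
  have hBc : ∀ k : ℕ, Continuous fun x : ℝ ↦ winOp (limKernel θ) t f x / ((k : ℝ) + 1) -
      2 * ∫ v in Ioi (0 : ℝ), Real.exp ((-2 * (k : ℝ) - 1 / 2) * v) * winOp (limKernel θ) t f (x - v) := fun k ↦
    (hGc.div_const _).sub (continuous_const.mul (continuous_gaussWeight_winOp hθ hf k))
  have hFi : ∀ k, Integrable (F k) (volume.restrict (Ioo (-t) t)) := fun k ↦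
    ((hGc.mul (hBc k)).continuousOn.integrableOn_compact isCompact_Icc).mono_set Ioo_subset_Icc_self
  have hvol : volume (Ioo (-t) t) < ⊤ := measure_Ioo_lt_top
  have hFs : Summable fun k ↦ ∫ x in Ioo (-t) t, ‖F k x‖ := by
    refine ((hsum.mul_left (MG * L)).mul_right (volume (Ioo (-t) t)).toReal).of_nonneg_of_le
      (fun k ↦ integral_nonneg fun _ ↦ norm_nonneg _) fun k ↦ ?_
    have hpt : ∀ x ∈ Ioo (-t) t, ‖‖F k x‖‖ ≤ MG * L * (4 * π * (3 * M / ((k : ℝ) + 1) ^ 2 +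
        (2 * C + 4 * M) * Real.Gamma (ε + 1) * (1 / (2 * (k : ℝ) + 1 / 2)) ^ (ε + 1))) := by
      intro x hx
      rw [norm_norm, hF, norm_mul, Real.norm_eq_abs, Real.norm_eq_abs]
      have h1 := hMG x hx.2.le
      have h2 := abs_gaussInner_le hθ hf hτ k hx.2.le
      calc |winOp (limKernel θ) t f x| * |winOp (limKernel θ) t f x / ((k : ℝ) + 1) -
            2 * ∫ v in Ioi (0 : ℝ), Real.exp ((-2 * (k : ℝ) - 1 / 2) * v) * winOp (limKernel θ) t f (x - v)|
          ≤ MG * (4 * π * (3 * M / ((k : ℝ) + 1) ^ 2 +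
              (2 * C + 4 * M) * Real.Gamma (ε + 1) * (1 / (2 * (k : ℝ) + 1 / 2)) ^ (ε + 1)) * L) :=
            mul_le_mul h1 h2 (abs_nonneg _) hMG0
        _ = MG * L * (4 * π * (3 * M / ((k : ℝ) + 1) ^ 2 +
              (2 * C + 4 * M) * Real.Gamma (ε + 1) * (1 / (2 * (k : ℝ) + 1 / 2)) ^ (ε + 1))) := by ring
    have h := norm_setIntegral_le_of_norm_le_const hvol hpt
    rw [Real.norm_eq_abs, abs_of_nonneg (integral_nonneg fun _ ↦ norm_nonneg _)] at h
    exact h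
  have h := integral_tsum_of_summable_integral_norm hFi hFs
  have hlhs : ∫ x in Ioo (-t) t, winOp (limKernel θ) t f x *
      ∑' k : ℕ, (winOp (limKernel θ) t f x / ((k : ℝ) + 1) -
        2 * ∫ v in Ioi (0 : ℝ), Real.exp ((-2 * (k : ℝ) - 1 / 2) * v) * winOp (limKernel θ) t f (x - v)) =
      ∫ x in Ioo (-t) t, ∑' k : ℕ, F k x := by
    refine setIntegral_congr_fun measurableSet_Ioo fun x _ ↦ ?_
    rw [← tsum_mul_left]
  rw [hlhs, ← h]
  refine tsum_congr fun k ↦ ?_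
  -- `∫ F k = Φ(0)/(k+1) − 2∫ e Φ`
  have hI1 : IntegrableOn (fun x ↦ winOp (limKernel θ) t f x * winOp (limKernel θ) t f x) (Ioo (-t) t) :=
    ((hGc.mul hGc).continuousOn.integrableOn_compact isCompact_Icc).mono_set Ioo_subset_Icc_self
  have hI2 : IntegrableOn (fun x ↦ winOp (limKernel θ) t f x *
      ∫ v in Ioi (0 : ℝ), Real.exp ((-2 * (k : ℝ) - 1 / 2) * v) * winOp (limKernel θ) t f (x - v)) (Ioo (-t) t) :=
    ((hGc.mul (continuous_gaussWeight_winOp hθ hf k)).continuousOn.integrableOn_compact isCompact_Icc).mono_set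
      Ioo_subset_Icc_self
  have hsplit : F k = fun x ↦ (1 / ((k : ℝ) + 1)) * (winOp (limKernel θ) t f x * winOp (limKernel θ) t f x) -
      2 * (winOp (limKernel θ) t f x *
        ∫ v in Ioi (0 : ℝ), Real.exp ((-2 * (k : ℝ) - 1 / 2) * v) * winOp (limKernel θ) t f (x - v)) := by
    funext x; simp only [hF]; ring
  rw [hsplit, integral_sub (hI1.const_mul _) (hI2.const_mul _), integral_const_mul, integral_const_mul,
    integral_winOp_mul_expPiece hθ hf]
  ring

end Summit.RiemannHypothesis.RiemannHypothesis.Theorems.SuzukiThetaFlow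

end
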